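import Literature.Geometry.Kaehler.ComplexTorusSimpleAbelianSevenfoldHodgeEqLefschetz
import Literature.Geometry.Kaehler.ComplexTorusRosatiCM
import Literature.Geometry.Kaehler.ComplexTorusLieAlgebraBracketBaseChange
import Literature.Geometry.Kaehler.ComplexTorusLefschetzGroupDimensionCriterion
import HarnessLib

/-!
# `dim Lie S(X) = 2g² ∕ [F : ℚ]` for a polarised complex torus with `End⁰(X) = F` a CM field; `dim U_K(V,ψ) = g²` for an
# imaginary quadratic `K` (Milne's table, type IV, `d = 1`), hence `dim Hg(X) = g²` for the abelian varieties of RIBET TYPE and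
# `dim Hg(X) = 9, 25, 49` for the simple abelian varieties of type IV(1) in dimension `3, 5, 7`

Layer `Literature/Geometry/Kaehler`, namespace `Literature.Geometry.Kaehler.ComplexTorus`; lane `lit-hodgefound` (Track 2
foundations library); prover seat `lit-hodgefound-p17`, generation 58, self-proposed row g58-#9 — the DIMENSION column of the
generation's Ribet-type theorems (✔ gen-56 `(m,1)`, ✔ g58-#6 `(2, odd)` ∕ `(3, b)`, ✔ g58-#5 `g = 5`, ✔ g58-#7 `g = 7`: `Hg(X) = Lf(X) =
U_K(V,ψ)`; here `dim U_K(V,ψ) = g²`).  THEOREMS ONLY (no definition, no instance, no named fact; D-0026 net debt `0`).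

## Sources

* J. S. Milne [Milne1999LefschetzClasses], *Lefschetz classes on abelian varieties*, Duke Math. J. **96** (1999) [corpus:
  paper:doi-10-1215-s0012-7094-99-09620-5], §1 (p. 644: «`S(A)(R) = {γ ∈ C(A) ⊗_k R ∣ γ†γ = 1}`», `C(A)` the centraliser of
  `End⁰(A)` in `End_k(V(A))`), §2 Summary table (p0014 = p. 652): «Type IV · Group `GL_{g/df}` · Connected Yes · Dimension `g²/(d²f)` …
  The group `S(A)/k^{al}` is isomorphic to `f` copies of the group listed».  For `End⁰(X) = F` a CM field (`d = 1`, `2f = [F : ℚ]`):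
  `dim S(X) = g²/f = 2g²/[F : ℚ]`; `F = K` imaginary quadratic: `dim = g²`; `[F : ℚ] = 2g` (complex multiplication): `dim = g`.
* B. Moonen, Yu. Zarhin [MoonenZarhin1999LowDim], Math. Ann. **315** (1999) [corpus: paper:arxiv-math_9901113], §2 (2.3) Type IV(1,1)
  (p0005 L98–L101): «`End⁰(X) = F` is an imaginary quadratic field; given `a ∈ F` with `ā = −a` there is a unique `F`-hermitian form
  `ψ` … such that `φ = trace_{F/ℚ}(a·ψ)` and `Hg(X) = U_F(V,ψ)`»; (p0005 L130–L131): «Thus `Hg(X)_ℝ` is a unitary group of signature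
  `(2,1)`»; Thm. (2.7) (p0006 L9–L11).
* P. Deligne [Deligne1982HodgeCycles], LNM 900, I Prop. 5.1 (the Rosati involution is complex conjugation on a CM endomorphism field) —
  the tree's `rosati_eq_complexConj_of_range_eq_endAlgRat`.
* J. Voight [Voight2021], *Quaternion algebras*, §7.7 Prop. 7.7.8 (b) («`dim_F B = dim_F A · dim_F C_B(A)`» for a simple subalgebra).

## The argument (Milne §1–§2 unwound; no classification)

§1 For ANY `f : F →ₐ[ℚ] M_ι(ℚ)` from a number field: `ℚ^ι` is an `F`-vector space through `f`, the centraliser `C(f F)` of `f(F)` in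
`M_ι(ℚ)` is `End_F(ℚ^ι)`, so `[F : ℚ] · dim_ℚ C(f F) = (#ι)²` (`= [F:ℚ]² · (dim_F ℚ^ι)²`).  §2 For `(X, η)` polarised with rational Gram
matrix `G` and `End⁰(X) = f(F)`, `F` a CM field: the Rosati involution `† = (A ↦ G⁻¹ ᵗA G)` is complex conjugation on `f(F)` (Deligne),
hence preserves `C(f F)`; `C = C⁺ ⊕ C⁻` (`†`-symmetric ∕ `†`-skew), `C⁻ = Lie S(X)` (Milne: the tree's `mem_lefschetzLieRat_iff_rosati`),
and left multiplication by `f(x₀)` for a non-zero totally imaginary `x₀ ∈ F` (`x̄₀ = −x₀`) exchanges `C⁺` and `C⁻` — so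
`2 · dim_ℚ Lie S(X) = dim_ℚ C(f F)` and **`[F : ℚ] · dim Lie S(X) = 2g²`**.  §3 `[F : ℚ] = 2`: `dim_ℝ 𝔩𝔣 = dim_ℂ 𝔩𝔣_ℂ = g²`; with
`ℬ• = 𝒟•` ⟺ `dim 𝔥𝔤_ℝ = dim 𝔩𝔣` for commutative `End⁰` (the tree's g49 criterion) every Ribet-type theorem of the tree gives
**`dim_ℝ 𝔥𝔤_ℝ = g²`**; instances `g = 3, 5, 7` (type IV(1): `9, 25, 49`) and the CM case `[F : ℚ] = 2g`: `dim Lie S(X) = g`.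
-/

noncomputable section

open scoped Matrix ComplexConjugate
open Module Matrix Complex Function NumberField

namespace Literature.Geometry.Kaehler

namespace ComplexTorus

/-! ## §1 The centraliser of a subfield of `M_ι(ℚ)`: `[F : ℚ] · dim_ℚ C(f F) = (#ι)²` -/

section Centralizer

variable {ι : Type} [Fintype ι] [DecidableEq ι] {K : Type*} [Field K] [Algebra ℚ K] [FiniteDimensional ℚ K]

/-- **`[F : ℚ] · dim_ℚ C_{M_ι(ℚ)}(f F) = (#ι)²`**: through `f : F →ₐ[ℚ] M_ι(ℚ)` the space `ℚ^ι` is an `F`-vector space, the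
centraliser of `f(F)` is `End_F(ℚ^ι)` (of `F`-dimension `(dim_F ℚ^ι)²`), and `[F : ℚ] · dim_F ℚ^ι = #ι`.
[cite: Milne1999LefschetzClasses, §1 (p. 643–644: the centraliser `C(A)`) and §2 (type IV, `C(A) ⊗ k^{al} ≅ ∏ M`)] [cite: Voight2021, §7.7 Prop. 7.7.8 (b)] -/
theorem finrank_mul_finrank_centralizer_range_algHom_eq_card_sq (f : K →ₐ[ℚ] Matrix ι ι ℚ) :
    finrank ℚ K * finrank ℚ ↥(Subalgebra.centralizer ℚ (Set.range f)) = Fintype.card ι ^ 2 := by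
  -- `ℚ^ι` as an `F`-module through `f`
  let f' : K →+* Module.End ℚ (ι → ℚ) :=
    ((Matrix.toLinAlgEquiv' : Matrix ι ι ℚ ≃ₐ[ℚ] Module.End ℚ (ι → ℚ)) : Matrix ι ι ℚ →+* Module.End ℚ (ι → ℚ)).comp
      (f : K →+* Matrix ι ι ℚ)
  letI instK : Module K (ι → ℚ) := Module.compHom (ι → ℚ) f'
  have smul_def : ∀ (y : K) (v : ι → ℚ), y • v = f y *ᵥ v := fun y v ↦ Matrix.toLin'_apply (f y) v
  haveI : IsScalarTower ℚ K (ι → ℚ) :=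
    ⟨fun q y v ↦ by rw [smul_def, smul_def, map_smul, Matrix.smul_mulVec]⟩
  haveI : SMulCommClass K ℚ (ι → ℚ) := ⟨fun y q v ↦ by rw [smul_def, smul_def, Matrix.mulVec_smul]⟩
  haveI : SMulCommClass ℚ K (ι → ℚ) := SMulCommClass.symm K ℚ (ι → ℚ)
  haveI : Module.Finite K (ι → ℚ) := Module.Finite.of_restrictScalars_finite ℚ K (ι → ℚ)
  have hV : finrank ℚ K * finrank K (ι → ℚ) = Fintype.card ι := by
    rw [Module.finrank_mul_finrank, Module.finrank_fintype_fun_eq_card]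
  -- `End_F(ℚ^ι)` as a `ℚ`-space
  have hW : finrank ℚ ((ι → ℚ) →ₗ[K] (ι → ℚ)) = finrank ℚ K * (finrank K (ι → ℚ) * finrank K (ι → ℚ)) := by
    rw [← Module.finrank_mul_finrank ℚ K ((ι → ℚ) →ₗ[K] (ι → ℚ)), Module.finrank_linearMap]
  haveI : FiniteDimensional ℚ ((ι → ℚ) →ₗ[K] (ι → ℚ)) := Module.Finite.trans K _
  -- the centraliser is `End_F(ℚ^ι)`
  set C := Subalgebra.centralizer ℚ (Set.range f) with hCdef
  have memC : ∀ {A : Matrix ι ι ℚ}, A ∈ C ↔ ∀ y : K, f y * A = A * f y := fun {A} ↦ by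
    rw [hCdef, Subalgebra.mem_centralizer_iff]
    exact ⟨fun h y ↦ h _ (Set.mem_range_self y), fun h B ⟨y, hy⟩ ↦ hy ▸ h y⟩
  let φ : ↥C →ₗ[ℚ] ((ι → ℚ) →ₗ[K] (ι → ℚ)) :=
    { toFun := fun Z ↦
        { toFun := fun v ↦ Z.1 *ᵥ v
          map_add' := fun v w ↦ Matrix.mulVec_add _ _ _
          map_smul' := fun y v ↦ by
            rw [RingHom.id_apply, smul_def, smul_def, Matrix.mulVec_mulVec, Matrix.mulVec_mulVec, (memC.1 Z.2 y)] }
      map_add' := fun Z Z' ↦ by ext v; simp [Matrix.add_mulVec]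
      map_smul' := fun q Z ↦ by ext v; simp [Matrix.smul_mulVec] }
  have hφ : Function.Injective φ := by
    intro Z Z' h
    apply Subtype.ext
    have h' : ∀ v, Z.1 *ᵥ v = Z'.1 *ᵥ v := fun v ↦ by
      simpa [φ] using LinearMap.congr_fun h v
    exact (Matrix.toLin'.injective (LinearMap.ext fun v ↦ by rw [Matrix.toLin'_apply, Matrix.toLin'_apply, h' v]))
  let ψ : ((ι → ℚ) →ₗ[K] (ι → ℚ)) →ₗ[ℚ] ↥C :=
    { toFun := fun T ↦ ⟨LinearMap.toMatrix' (T.restrictScalars ℚ), memC.2 fun y ↦ by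
          apply Matrix.toLin'.injective
          apply LinearMap.ext
          intro v
          rw [Matrix.toLin'_mul, Matrix.toLin'_mul, Matrix.toLin'_toMatrix', LinearMap.comp_apply, LinearMap.comp_apply,
            LinearMap.restrictScalars_apply, LinearMap.restrictScalars_apply, Matrix.toLin'_apply, Matrix.toLin'_apply, ← smul_def,
            ← smul_def, T.map_smul]⟩
      map_add' := fun T T' ↦ by ext1; simp
      map_smul' := fun q T ↦ by ext1; simp }
  have hψ : Function.Injective ψ := by
    intro T T' h
    have h' : LinearMap.toMatrix' (T.restrictScalars ℚ) = LinearMap.toMatrix' (T'.restrictScalars ℚ) := congr_arg Subtype.val h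
    have h'' := LinearMap.toMatrix'.injective h'
    exact LinearMap.restrictScalars_injective ℚ h''
  have hCW : finrank ℚ ↥C = finrank ℚ ((ι → ℚ) →ₗ[K] (ι → ℚ)) :=
    le_antisymm (LinearMap.finrank_le_finrank_of_injective hφ) (LinearMap.finrank_le_finrank_of_injective hψ)
  rw [hCW, hW, ← mul_assoc, sq, ← hV]
  ring

end Centralizer

/-! ## §2 `[F : ℚ] · dim Lie S(X) = 2g²` for `End⁰(X) = F` a CM field -/

section CMField

variable {ι : Type} [Fintype ι] [DecidableEq ι] [Nonempty ι] {E : Type} [NormedAddCommGroup E] [NormedSpace ℂ E]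
  [FiniteDimensional ℂ E] {Φ : (ι → ℝ) ≃L[ℝ] E} {η : E [⋀^Fin 2]→L[ℝ] ℝ} {G : Matrix ι ι ℚ}
  {K : Type} [Field K] [NumberField K] [IsCMField K]

omit [FiniteDimensional ℂ E] in
/-- **`2 · dim_ℚ Lie S(X) = dim_ℚ C(End⁰ X)` FOR `End⁰(X) = F` A CM FIELD**: the Rosati involution `†` of the polarisation is complex
conjugation on `f(F)` (Deligne I 5.1), so it preserves the centraliser `C = C(f F)`; `C = C⁺ ⊕ C⁻` with `C⁻ = Lie S(X) = {γ ∈ C ∣ γ† = −γ}`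
(Milne §1), and `A ↦ f(x₀) A` for a non-zero `x₀ ∈ F` with `x̄₀ = −x₀` exchanges `C⁺` and `C⁻`.
[cite: Milne1999LefschetzClasses, §1 (p. 644: «`S(A)(R) = {γ ∈ C(A) ⊗_k R ∣ γ†γ = 1}`»)] [cite: Deligne1982HodgeCycles, I Prop. 5.1]
[cite: Lange2023AbelianVarietiesComplex, §5.5 (eigenspaces of the Rosati involution)] -/
theorem IsRiemannForm.two_mul_finrank_lefschetzLieRat_eq_finrank_centralizer (hη : IsRiemannForm Φ η)
    (hG : G.map (Rat.cast : ℚ → ℝ) = latticeGram Φ η) (f : K →ₐ[ℚ] Matrix ι ι ℚ) (hfE : f.range = endAlgRat Φ) :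
    2 * finrank ℚ (lefschetzLieRat Φ G) = finrank ℚ ↥(Subalgebra.centralizer ℚ (Set.range f)) := by
  letI : LieRing (Matrix ι ι ℚ) := LieRing.ofAssociativeRing
  have hGu : IsUnit G.det := isUnit_det_of_map_ratCast hG hη.isUnit_det_latticeGram
  have hGt : Gᵀ = -G := transpose_eq_neg_of_map_ratCast Φ hG
  have hconj : ∀ x, rosati G (f x) = f (IsCMField.complexConj K x) :=
    ComplexTorus.rosati_eq_complexConj_of_range_eq_endAlgRat Φ hη.1 hη.2.2 hG f hfE
  set C := Subalgebra.centralizer ℚ (Set.range f) with hCdef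
  have memC : ∀ {A : Matrix ι ι ℚ}, A ∈ C ↔ ∀ y : K, f y * A = A * f y := fun {A} ↦ by
    rw [hCdef, Subalgebra.mem_centralizer_iff]
    exact ⟨fun h y ↦ h _ (Set.mem_range_self y), fun h B ⟨y, hy⟩ ↦ hy ▸ h y⟩
  have hfmem : ∀ {B : Matrix ι ι ℚ}, B ∈ endAlgRat Φ ↔ ∃ y, f y = B := fun {B} ↦ by
    rw [← hfE, AlgHom.mem_range]
  -- `Lie S(X) = C⁻`
  change 2 * finrank ℚ (lefschetzLieRat Φ G).toSubmodule = _
  set W := (lefschetzLieRat Φ G).toSubmodule with hW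
  have memW : ∀ A, A ∈ W ↔ A ∈ C ∧ rosati G A = -A := fun A ↦ by
    rw [hW, LieSubalgebra.mem_toSubmodule, mem_lefschetzLieRat_iff_rosati hGu, memC]
    refine ⟨fun h ↦ ⟨fun y ↦ (h.1 (f y) (hfmem.2 ⟨y, rfl⟩)).symm, h.2⟩, fun h ↦ ⟨fun B hB ↦ ?_, h.2⟩⟩
    obtain ⟨y, rfl⟩ := hfmem.1 hB
    exact (h.1 y).symm
  -- `†` preserves `C`
  have rosC : ∀ {A : Matrix ι ι ℚ}, A ∈ C → rosati G A ∈ C := fun {A} hA ↦ by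
    refine memC.2 fun y ↦ ?_
    have h := memC.1 hA (IsCMField.complexConj K y)
    have h1 := congr_arg (rosati G) h
    rw [rosati_mul hGu, rosati_mul hGu, hconj, IsCMField.complexConj_apply_apply] at h1
    exact h1.symm
  -- `C⁺`
  let S : Submodule ℚ (Matrix ι ι ℚ) :=
    { carrier := {A | A ∈ C ∧ rosati G A = A}
      add_mem' := fun {A B} hA hB ↦ ⟨C.add_mem hA.1 hB.1, by rw [rosati_add, hA.2, hB.2]⟩
      zero_mem' := ⟨C.zero_mem, by rw [show rosati G (0 : Matrix ι ι ℚ) = 0 from by simp [rosati_def]]⟩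
      smul_mem' := fun c {A} hA ↦ ⟨C.smul_mem hA.1 c, by rw [rosati_smul, hA.2]⟩ }
  have memS : ∀ A, A ∈ S ↔ A ∈ C ∧ rosati G A = A := fun A ↦ Iff.rfl
  -- `C = C⁺ ⊕ C⁻`
  have hinf : W ⊓ S = ⊥ := by
    rw [Submodule.eq_bot_iff]
    intro A hA
    obtain ⟨hAW, hAS⟩ := Submodule.mem_inf.1 hA
    have h1 := ((memS A).1 hAS).2
    have h2 := ((memW A).1 hAW).2
    have h : (2 : ℚ) • A = 0 := by rw [two_smul]; nth_rw 1 [← h1]; rw [h2, neg_add_cancel]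
    exact (smul_eq_zero.1 h).resolve_left two_ne_zero
  have hsup : W ⊔ S = Subalgebra.toSubmodule C := by
    refine le_antisymm (sup_le (fun A hA ↦ ((memW A).1 hA).1) fun A hA ↦ ((memS A).1 hA).1) fun A hA ↦ ?_
    rw [Subalgebra.mem_toSubmodule] at hA
    rw [Submodule.mem_sup]
    refine ⟨(1 / 2 : ℚ) • (A - rosati G A), ?_, (1 / 2 : ℚ) • (A + rosati G A), ?_, ?_⟩
    · rw [memW]
      exact ⟨C.smul_mem (C.sub_mem hA (rosC hA)) _,
        by rw [rosati_smul, rosati_sub, rosati_rosati hGu hGt, ← smul_neg, neg_sub]⟩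
    · rw [memS]
      exact ⟨C.smul_mem (C.add_mem hA (rosC hA)) _, by rw [rosati_smul, rosati_add, rosati_rosati hGu hGt, add_comm]⟩
    · rw [← smul_add, sub_add_add_cancel, ← two_smul ℚ, smul_smul]
      norm_num
  have hdim := Submodule.finrank_sup_add_finrank_inf_eq W S
  rw [hinf, finrank_bot, add_zero, hsup, Subalgebra.finrank_toSubmodule] at hdim
  -- a non-zero totally imaginary `x₀`
  obtain ⟨x₀, hx0, hxbar⟩ : ∃ x₀ : K, x₀ ≠ 0 ∧ IsCMField.complexConj K x₀ = -x₀ := by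
    obtain ⟨x, hx⟩ : ∃ x : K, IsCMField.complexConj K x ≠ x := by
      by_contra! h
      exact IsCMField.complexConj_ne_one K (AlgEquiv.ext h)
    exact ⟨x - IsCMField.complexConj K x, sub_ne_zero.2 hx.symm, by rw [map_sub, IsCMField.complexConj_apply_apply, neg_sub]⟩
  have hθC : f x₀ ∈ C := memC.2 fun y ↦ by rw [← map_mul, ← map_mul, mul_comm]
  have hθinv : f x₀⁻¹ * f x₀ = 1 := by rw [← map_mul, inv_mul_cancel₀ hx0, map_one]
  -- `(f x₀ · A)† = −(f x₀ · A†)` on `C`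
  have key : ∀ {A : Matrix ι ι ℚ}, A ∈ C → rosati G (f x₀ * A) = -(f x₀ * rosati G A) := fun {A} hA ↦ by
    rw [rosati_mul hGu, hconj, hxbar, map_neg, mul_neg, memC.1 (rosC hA) x₀]
  -- the two injections `C⁻ ↪ C⁺`, `C⁺ ↪ C⁻`
  have inj : ∀ {A : Matrix ι ι ℚ}, f x₀ * A = 0 → A = 0 := fun {A} h ↦ by
    rw [← one_mul A, ← hθinv, mul_assoc, h, mul_zero]
  let m₁ : W →ₗ[ℚ] S :=
    { toFun := fun A ↦ ⟨f x₀ * A.1, C.mul_mem hθC ((memW A.1).1 A.2).1,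
        by rw [key ((memW A.1).1 A.2).1, ((memW A.1).1 A.2).2, mul_neg, neg_neg]⟩
      map_add' := fun A B ↦ by ext1; simp [mul_add]
      map_smul' := fun c A ↦ by ext1; simp }
  let m₂ : S →ₗ[ℚ] W :=
    { toFun := fun A ↦ ⟨f x₀ * A.1, (memW _).2 ⟨C.mul_mem hθC ((memS A.1).1 A.2).1,
        by rw [key ((memS A.1).1 A.2).1, ((memS A.1).1 A.2).2]⟩⟩
      map_add' := fun A B ↦ by ext1; simp [mul_add]
      map_smul' := fun c A ↦ by ext1; simp }
  have hm₁ : Function.Injective m₁ := by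
    intro A B h
    have h' : f x₀ * A.1 = f x₀ * B.1 := congr_arg Subtype.val h
    exact Subtype.ext (sub_eq_zero.1 (inj (by rw [mul_sub, h', sub_self])))
  have hm₂ : Function.Injective m₂ := by
    intro A B h
    have h' : f x₀ * A.1 = f x₀ * B.1 := congr_arg Subtype.val h
    exact Subtype.ext (sub_eq_zero.1 (inj (by rw [mul_sub, h', sub_self])))
  have hWS : finrank ℚ W = finrank ℚ S :=
    le_antisymm (LinearMap.finrank_le_finrank_of_injective hm₁) (LinearMap.finrank_le_finrank_of_injective hm₂)
  omega

/-- **MILNE'S TABLE, TYPE IV WITH `d = 1`: `[F : ℚ] · dim_ℚ Lie S(X) = 2g²`** for a polarised complex torus `(X, η)` of dimension `g`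
with `End⁰(X) = f(F)`, `F` a CM field (`dim S(X) = g²/f`, `2f = [F : ℚ]`).
[cite: Milne1999LefschetzClasses, §2 Summary table (p. 652: type IV, dimension `g²/(d² f)`, `f` copies of `GL_{g/df}`)] [cite: Deligne1982HodgeCycles, I Prop. 5.1] -/
theorem IsRiemannForm.finrank_mul_finrank_lefschetzLieRat_eq (hη : IsRiemannForm Φ η)
    (hG : G.map (Rat.cast : ℚ → ℝ) = latticeGram Φ η) (f : K →ₐ[ℚ] Matrix ι ι ℚ) (hfE : f.range = endAlgRat Φ) :
    finrank ℚ K * finrank ℚ (lefschetzLieRat Φ G) = 2 * finrank ℂ E ^ 2 := by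
  have h1 := hη.two_mul_finrank_lefschetzLieRat_eq_finrank_centralizer hG f hfE
  have h2 := finrank_mul_finrank_centralizer_range_algHom_eq_card_sq f
  rw [card_eq_two_mul_finrank Φ] at h2
  have h3 : 2 * (finrank ℚ K * finrank ℚ (lefschetzLieRat Φ G)) = 2 * (2 * finrank ℂ E ^ 2) := by
    rw [mul_left_comm, h1, h2]; ring
  omega

/-- `[F : ℚ] · dim_ℝ 𝔩𝔣 = 2g²` (`𝔩𝔣 = Lie Lf(X)(ℝ) = Lie S(X) ⊗ ℝ`) for `End⁰(X) = F` a CM field.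
[cite: Milne1999LefschetzClasses, §2 Summary table (p. 652, type IV)] -/
theorem IsRiemannForm.finrank_mul_finrank_lefschetzLie_eq (hη : IsRiemannForm Φ η)
    (hG : G.map (Rat.cast : ℚ → ℝ) = latticeGram Φ η) (f : K →ₐ[ℚ] Matrix ι ι ℚ) (hfE : f.range = endAlgRat Φ) :
    finrank ℚ K * finrank ℝ (lefschetzLie Φ G) = 2 * finrank ℂ E ^ 2 := by
  rw [← finrank_lefschetzLieRat_eq_finrank_lefschetzLie]
  exact hη.finrank_mul_finrank_lefschetzLieRat_eq hG f hfE

/-- `[F : ℚ] · dim_ℂ 𝔩𝔣_ℂ = 2g²` (`𝔩𝔣_ℂ = Lie S(X)(ℂ)`) for `End⁰(X) = F` a CM field. [cite: Milne1999LefschetzClasses, §2 Summary table (p. 652, type IV) and Remark 1.6] -/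
theorem IsRiemannForm.finrank_mul_finrank_lefschetzLieC_eq (hη : IsRiemannForm Φ η)
    (hG : G.map (Rat.cast : ℚ → ℝ) = latticeGram Φ η) (f : K →ₐ[ℚ] Matrix ι ι ℚ) (hfE : f.range = endAlgRat Φ) :
    finrank ℚ K * finrank ℂ (lefschetzLieC Φ G) = 2 * finrank ℂ E ^ 2 := by
  rw [finrank_lefschetzLieC_eq_finrank_lefschetzLieRat Φ G]
  exact hη.finrank_mul_finrank_lefschetzLieRat_eq hG f hfE

/-- **`dim U_K(V,ψ) = g²`: `dim_ℝ 𝔩𝔣 = g²` when `End⁰(X) = K` is an IMAGINARY QUADRATIC field** («`Hg(X)_ℝ` is a unitary group of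
signature `(p, q)`», `p + q = g`, `dim U(p,q) = g²`). [cite: Milne1999LefschetzClasses, §2 Summary table (p. 652, type IV, `d = f = 1`)]
[cite: MoonenZarhin1999LowDim, §2 (2.3) Type IV(1,1) (p0005 L98–L101, L130–L131)] -/
theorem IsRiemannForm.finrank_lefschetzLie_eq_sq_of_finrank_eq_two (hη : IsRiemannForm Φ η)
    (hG : G.map (Rat.cast : ℚ → ℝ) = latticeGram Φ η) (hK : finrank ℚ K = 2) (f : K →ₐ[ℚ] Matrix ι ι ℚ)
    (hfE : f.range = endAlgRat Φ) : finrank ℝ (lefschetzLie Φ G) = finrank ℂ E ^ 2 := by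
  have h := hη.finrank_mul_finrank_lefschetzLie_eq hG f hfE
  rw [hK] at h
  omega

/-- `dim_ℂ 𝔩𝔣_ℂ = g²` when `End⁰(X) = K` is an imaginary quadratic field. [cite: Milne1999LefschetzClasses, §2 Summary table (p. 652, type IV)] -/
theorem IsRiemannForm.finrank_lefschetzLieC_eq_sq_of_finrank_eq_two (hη : IsRiemannForm Φ η)
    (hG : G.map (Rat.cast : ℚ → ℝ) = latticeGram Φ η) (hK : finrank ℚ K = 2) (f : K →ₐ[ℚ] Matrix ι ι ℚ)
    (hfE : f.range = endAlgRat Φ) : finrank ℂ (lefschetzLieC Φ G) = finrank ℂ E ^ 2 := by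
  rw [finrank_lefschetzLieC_eq_finrank_lefschetzLie]
  exact hη.finrank_lefschetzLie_eq_sq_of_finrank_eq_two hG hK f hfE

/-- **Complex multiplication, `[F : ℚ] = 2g`: `dim Lie S(X) = g`** («Type IV … Suppose `X` is of CM-type. Then `Hg(X)` is a `g`-dimensional
algebraic torus» — here the Lefschetz side `dim S(X) = g`). [cite: Milne1999LefschetzClasses, §2 Summary table (p. 652, type IV, `2f = 2g`)]
[cite: MoonenZarhin1999LowDim, §2 Prop. (2.5) (2) (p0005 L113–L116)] -/
theorem IsRiemannForm.finrank_lefschetzLie_eq_of_finrank_eq_two_mul (hη : IsRiemannForm Φ η)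
    (hG : G.map (Rat.cast : ℚ → ℝ) = latticeGram Φ η) (hK : finrank ℚ K = 2 * finrank ℂ E) (f : K →ₐ[ℚ] Matrix ι ι ℚ)
    (hfE : f.range = endAlgRat Φ) : finrank ℝ (lefschetzLie Φ G) = finrank ℂ E := by
  have h := hη.finrank_mul_finrank_lefschetzLie_eq hG f hfE
  have hE : 0 < finrank ℂ E := by
    have := card_eq_two_mul_finrank Φ
    have : 0 < Fintype.card ι := Fintype.card_pos
    omega
  rw [hK, sq, show 2 * (finrank ℂ E * finrank ℂ E) = 2 * finrank ℂ E * finrank ℂ E by ring] at h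
  exact Nat.eq_of_mul_eq_mul_left (by omega) h

end CMField

/-! ## §3 `dim Hg(X) = g²` for the abelian varieties of Ribet type; `9, 25, 49` for simple type IV(1) in dimension `3, 5, 7` -/

section Hodge

variable {ι : Type} [Fintype ι] [DecidableEq ι] [Nonempty ι] {E : Type} [NormedAddCommGroup E] [NormedSpace ℂ E]
  [FiniteDimensional ℂ E] {Φ : (ι → ℝ) ≃L[ℝ] E} {η : E [⋀^Fin 2]→L[ℝ] ℝ}
  {K : Type} [Field K] [NumberField K] [IsCMField K]

/-- **`dim Hg(X) = g²` WHENEVER `End⁰(X) = K` IS IMAGINARY QUADRATIC AND `ℬ•(Xᵏ) = 𝒟•(Xᵏ)` FOR ALL `k`** (equivalently `Hg(X) = U_K(V,ψ)`: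
for commutative `End⁰(X)`, `ℬ• = 𝒟•` on all powers ⟺ `dim 𝔥𝔤_ℝ = dim 𝔩𝔣`, the tree's g49 criterion; and `dim 𝔩𝔣 = g²`, §2).
[cite: MoonenZarhin1999LowDim, §1 (1.8) and §2 (2.3) Type IV(1,1) («`Hg(X) = U_F(V,ψ)`»)] [cite: Milne1999LefschetzClasses, §2 Summary table (p. 652) and §4 Prop. 4.8] -/
theorem IsRiemannForm.finrank_hodgeGroupLie_eq_sq_of_forall_divisorClasses_powPeriod_eq_hodgeClasses (hη : IsRiemannForm Φ η)
    (hK : finrank ℚ K = 2) (f : K →ₐ[ℚ] Matrix ι ι ℚ) (hfE : f.range = endAlgRat Φ)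
    (hD : ∀ k p : ℕ, divisorClasses (powPeriod Φ k) p = hodgeClasses (powPeriod Φ k) p) :
    finrank ℝ (hodgeGroupLie Φ) = finrank ℂ E ^ 2 := by
  obtain ⟨G, hG⟩ := hη.exists_ratMatrix_latticeGram
  have hE : 0 < finrank ℂ E := by
    have := card_eq_two_mul_finrank Φ
    have : 0 < Fintype.card ι := Fintype.card_pos
    omega
  have hcomm : ∀ a ∈ endAlgRat Φ, ∀ b ∈ endAlgRat Φ, a * b = b * a := by
    intro a ha b hb
    rw [← hfE, AlgHom.mem_range] at ha hb
    obtain ⟨x, rfl⟩ := ha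
    obtain ⟨y, rfl⟩ := hb
    rw [← map_mul, ← map_mul, mul_comm]
  rw [(hη.forall_divisorClasses_powPeriod_eq_hodgeClasses_iff_finrank_eq_of_endAlgRat_comm hG hE hcomm).1 hD,
    hη.finrank_lefschetzLie_eq_sq_of_finrank_eq_two hG hK f hfE]

/-- **RIBET TYPE `(g − 1, 1)`: `dim Hg(X) = g²`** (`n_σ = 1`, `g ≠ 2`; ✔ gen-56 `Hg = Lf` by Kostant's coisotropic theorem).
[cite: Ribet1983, Thm. 3 (`(n, 1)`)] [cite: MoonenZarhin1999LowDim, §2 (2.3) Type IV(1,1)] [cite: Milne1999LefschetzClasses, §2 Summary table (p. 652)] -/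
theorem IsRiemannForm.finrank_hodgeGroupLie_eq_sq_of_finrank_iInf_eigenspace_analyticRepHom_eq_one (hη : IsRiemannForm Φ η)
    (hK : finrank ℚ K = 2) (hg : finrank ℂ E ≠ 2) (f : K →ₐ[ℚ] Matrix ι ι ℚ) (hfE : f.range = endAlgRat Φ) (hf : ∀ y, f y ∈ endAlgRat Φ)
    (σ : K →+* ℂ) (h1 : finrank ℂ ↥(⨅ y : K, Module.End.eigenspace ((analyticRepHom Φ ⟨f y, hf y⟩ : E →L[ℂ] E) : E →ₗ[ℂ] E) (σ y)) = 1) :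
    finrank ℝ (hodgeGroupLie Φ) = finrank ℂ E ^ 2 :=
  hη.finrank_hodgeGroupLie_eq_sq_of_forall_divisorClasses_powPeriod_eq_hodgeClasses hK f hfE
    (hη.forall_divisorClasses_powPeriod_eq_hodgeClasses_of_finrank_eq_two_of_finrank_iInf_eigenspace_analyticRepHom_eq_one
      hK hg f hfE hf σ h1)

/-- **RIBET TYPE `(g − 2, 2)`, `g` ODD: `dim Hg(X) = g²`** (✔ g58-#6). [cite: Ribet1983, Thm. 3] [cite: MoonenZarhin1999LowDim, §2 (2.3) Type IV(1,1) and (p0005 L128–L129: «`k` acts … with multiplicities (3,2)»)]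
[cite: Milne1999LefschetzClasses, §2 Summary table (p. 652)] -/
theorem IsRiemannForm.finrank_hodgeGroupLie_eq_sq_of_odd_of_finrank_iInf_eigenspace_analyticRepHom_eq_two (hη : IsRiemannForm Φ η)
    (hK : finrank ℚ K = 2) (hg : Odd (finrank ℂ E)) (f : K →ₐ[ℚ] Matrix ι ι ℚ) (hfE : f.range = endAlgRat Φ)
    (hf : ∀ y, f y ∈ endAlgRat Φ) (σ : K →+* ℂ)
    (h2 : finrank ℂ ↥(⨅ y : K, Module.End.eigenspace ((analyticRepHom Φ ⟨f y, hf y⟩ : E →L[ℂ] E) : E →ₗ[ℂ] E) (σ y)) = 2) :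
    finrank ℝ (hodgeGroupLie Φ) = finrank ℂ E ^ 2 :=
  hη.finrank_hodgeGroupLie_eq_sq_of_forall_divisorClasses_powPeriod_eq_hodgeClasses hK f hfE
    (hη.forall_divisorClasses_powPeriod_eq_hodgeClasses_of_odd_of_finrank_iInf_eigenspace_analyticRepHom_eq_two hK hg f hfE hf σ h2)

/-- **RIBET TYPE `(g − 3, 3)`, `3 ∤ g`: `dim Hg(X) = g²`** (✔ g58-#6). [cite: Ribet1983, Thm. 3] [cite: Milne1999LefschetzClasses, §2 Summary table (p. 652)] -/
theorem IsRiemannForm.finrank_hodgeGroupLie_eq_sq_of_not_three_dvd_of_finrank_iInf_eigenspace_analyticRepHom_eq_three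
    (hη : IsRiemannForm Φ η) (hK : finrank ℚ K = 2) (hg : ¬ 3 ∣ finrank ℂ E) (f : K →ₐ[ℚ] Matrix ι ι ℚ) (hfE : f.range = endAlgRat Φ)
    (hf : ∀ y, f y ∈ endAlgRat Φ) (σ : K →+* ℂ)
    (h3 : finrank ℂ ↥(⨅ y : K, Module.End.eigenspace ((analyticRepHom Φ ⟨f y, hf y⟩ : E →L[ℂ] E) : E →ₗ[ℂ] E) (σ y)) = 3) :
    finrank ℝ (hodgeGroupLie Φ) = finrank ℂ E ^ 2 :=
  hη.finrank_hodgeGroupLie_eq_sq_of_forall_divisorClasses_powPeriod_eq_hodgeClasses hK f hfE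
    (hη.forall_divisorClasses_powPeriod_eq_hodgeClasses_of_not_three_dvd_of_finrank_iInf_eigenspace_analyticRepHom_eq_three hK hg f
      hfE hf σ h3)

end Hodge

section Simple

variable {κ : Type} [Fintype κ] [DecidableEq κ] [Nonempty κ] {E : Type} [NormedAddCommGroup E] [NormedSpace ℂ E]
  [FiniteDimensional ℂ E] {Ψ : (κ → ℝ) ≃L[ℝ] E} {η : E [⋀^Fin 2]→L[ℝ] ℝ}

/-- **SIMPLE ABELIAN FIVEFOLD OF TYPE IV(1) (signatures `(4,1)`, `(3,2)`): `dim Hg(X) = 25`** (✔ g58-#5: `Hg = U_K(V,ψ)`).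
[cite: MoonenZarhin1999LowDim, §2 (p0005 L124–L129) and Thm. (2.7)] [cite: Milne1999LefschetzClasses, §2 Summary table (p. 652)] -/
theorem IsSimple.finrank_hodgeGroupLie_eq_of_finrank_centerField_eq_two_of_finrank_eq_five (hX : IsSimple Ψ)
    (hη : IsRiemannForm Ψ η) (h5 : finrank ℂ E = 5) (he : finrank ℚ (centerField Ψ hX) = 2) : finrank ℝ (hodgeGroupLie Ψ) = 25 := by
  rcases hX.centerField_isTotallyReal_or_isCMField hη with hR | hCM
  · haveI := hR
    rcases hX.finrank_centerField_eq_one_or_eq_five_of_isTotallyReal h5 with h | h <;> omega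
  · haveI := hCM
    rw [hη.finrank_hodgeGroupLie_eq_sq_of_forall_divisorClasses_powPeriod_eq_hodgeClasses he (centerField.valAlgHom Ψ hX)
      (hX.range_valAlgHom_eq_endAlgRat_of_finrank_eq_five h5) (hX.forall_divisorClasses_powPeriod_eq_hodgeClasses_of_finrank_eq_five hη h5),
      h5]
    norm_num

/-- **SIMPLE ABELIAN SEVENFOLD OF TYPE IV(1) (signatures `(6,1)`, `(5,2)`, `(4,3)`): `dim Hg(X) = 49`** (✔ g58-#7: `Hg = U_K(V,ψ)`).
[cite: MoonenZarhin1999LowDim, Thm. (2.7)] [cite: Ribet1983, Thm. 3] [cite: Milne1999LefschetzClasses, §2 Summary table (p. 652)] -/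
theorem IsSimple.finrank_hodgeGroupLie_eq_of_finrank_centerField_eq_two_of_finrank_eq_seven (hX : IsSimple Ψ)
    (hη : IsRiemannForm Ψ η) (h7 : finrank ℂ E = 7) (he : finrank ℚ (centerField Ψ hX) = 2) : finrank ℝ (hodgeGroupLie Ψ) = 49 := by
  rcases hX.centerField_isTotallyReal_or_isCMField hη with hR | hCM
  · haveI := hR
    rcases hX.finrank_centerField_eq_one_or_eq_seven_of_isTotallyReal h7 with h | h <;> omega
  · haveI := hCM
    rw [hη.finrank_hodgeGroupLie_eq_sq_of_forall_divisorClasses_powPeriod_eq_hodgeClasses he (centerField.valAlgHom Ψ hX)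
      (hX.range_valAlgHom_eq_endAlgRat_of_finrank_eq_seven h7) (hX.forall_divisorClasses_powPeriod_eq_hodgeClasses_of_finrank_eq_seven hη h7),
      h7]
    norm_num

/-- **THE DIMENSION OF THE HODGE GROUP OF A SIMPLE COMPLEX ABELIAN FIVEFOLD: `(e, dim Hg) ∈ {(1, 55), (5, 15), (2, 25), (10, 5)}`**
(`e = [Z(End⁰X) : ℚ]`; I(1): `Hg = Sp₁₀`; I(5): `Hg = R_{F/ℚ} SL₂`, `3g`; IV(1): `Hg = U_K(V,ψ)`, `g²`; IV(5,·): a `g`-dimensional torus — the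
CM type of a simple CM abelian variety of prime dimension is nondegenerate (Hazama ∕ Gordon 6.4 with ✔ g58-#5)).
[cite: MoonenZarhin1999LowDim, §2 (2.6) `g = 5` (p0005 L124 – p0006 L1) and Thm. (2.7)] [cite: Gordon1997, 1.13.3 and Thm. 6.3, 6.4]
[cite: Milne1999LefschetzClasses, §2 Summary table (p. 652)] -/
theorem IsSimple.finrank_centerField_and_finrank_hodgeGroupLie_of_finrank_eq_five (hX : IsSimple Ψ) (hη : IsRiemannForm Ψ η)
    (h5 : finrank ℂ E = 5) :
    (finrank ℚ (centerField Ψ hX) = 1 ∧ finrank ℝ (hodgeGroupLie Ψ) = 55) ∨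
      (finrank ℚ (centerField Ψ hX) = 5 ∧ finrank ℝ (hodgeGroupLie Ψ) = 15) ∨
      (finrank ℚ (centerField Ψ hX) = 2 ∧ finrank ℝ (hodgeGroupLie Ψ) = 25) ∨
      (finrank ℚ (centerField Ψ hX) = 10 ∧ finrank ℝ (hodgeGroupLie Ψ) = 5) := by
  rcases hX.finrank_centerField_mem_of_finrank_eq_five hη h5 with ⟨hR, he | he⟩ | ⟨hCM, he | he⟩
  · exact Or.inl ⟨he, hη.finrank_hodgeGroupLie_eq_of_finrank_eq_five_of_endAlgRat_eq_bot h5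
      (hX.endAlgRat_eq_bot_of_finrank_eq_one_of_finrank_centerField_eq_one (hX.finrank_centerField_endAlgRat_eq_one_of_finrank_eq_five h5) he)⟩
  · haveI := hR
    refine Or.inr (Or.inl ⟨he, ?_⟩)
    rw [hX.finrank_hodgeGroupLie_eq_three_mul_of_finrank_centerField_eq hη (he.trans h5.symm), h5]
  · exact Or.inr (Or.inr (Or.inl ⟨he, hX.finrank_hodgeGroupLie_eq_of_finrank_centerField_eq_two_of_finrank_eq_five hη h5 he⟩))
  · haveI := hCM
    refine Or.inr (Or.inr (Or.inr ⟨he, ?_⟩))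
    have hdim : finrank ℚ (endAlgRat Ψ) = Fintype.card κ := by
      rw [← hX.range_valAlgHom_eq_endAlgRat_of_finrank_eq_five h5,
        ← (AlgEquiv.ofInjectiveField (centerField.valAlgHom Ψ hX)).toLinearEquiv.finrank_eq, he, card_eq_two_mul_finrank Ψ, h5]
    rw [← h5]
    exact (hX.forall_divisorClasses_powPeriod_eq_hodgeClasses_iff_finrank_hodgeGroupLie_eq_finrank_of_isCMField_of_endAlgRat_comm hη
      (hX.endAlgRat_comm_of_finrank_eq_five h5) hdim).1 (hX.forall_divisorClasses_powPeriod_eq_hodgeClasses_of_finrank_eq_five hη h5)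

omit [Nonempty κ] in
/-- **`dim_ℝ 𝔥𝔤_ℝ = 105 = dim Sp₁₄`** for an abelian sevenfold with `End_ℚ(X) = ℚ` (✔ g58-#1 `Hg = Sp₁₄`). [cite: MoonenZarhin1999LowDim, §2 (2.3) Type I(1) and Thm. (2.7)]
[cite: Lange2023AbelianVarietiesComplex, §7.3.1, proof of Prop. 7.3.2] -/
theorem IsRiemannForm.finrank_hodgeGroupLie_eq_of_finrank_eq_seven_of_endAlgRat_eq_bot {Φ : (κ → ℝ) ≃L[ℝ] E} (hη : IsRiemannForm Φ η)
    (h7 : finrank ℂ E = 7) (hE : endAlgRat Φ = ⊥) : finrank ℝ (hodgeGroupLie Φ) = 105 := by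
  rw [hη.hodgeGroup_eq_spGroup_iff_finrank_hodgeGroupLie_eq.1 (hη.hodgeGroup_eq_spGroup_of_finrank_eq_seven_of_endAlgRat_eq_bot h7 hE), h7]

/-- **THE DIMENSION OF THE HODGE GROUP OF A SIMPLE COMPLEX ABELIAN SEVENFOLD: `(e, dim Hg) ∈ {(1, 105), (7, 21), (2, 49), (14, 7)}`.**
[cite: MoonenZarhin1999LowDim, Thm. (2.7)] [cite: Gordon1997, 1.13.3 and Thm. 6.3, 6.4] [cite: Milne1999LefschetzClasses, §2 Summary table (p. 652)] -/
theorem IsSimple.finrank_centerField_and_finrank_hodgeGroupLie_of_finrank_eq_seven (hX : IsSimple Ψ) (hη : IsRiemannForm Ψ η)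
    (h7 : finrank ℂ E = 7) :
    (finrank ℚ (centerField Ψ hX) = 1 ∧ finrank ℝ (hodgeGroupLie Ψ) = 105) ∨
      (finrank ℚ (centerField Ψ hX) = 7 ∧ finrank ℝ (hodgeGroupLie Ψ) = 21) ∨
      (finrank ℚ (centerField Ψ hX) = 2 ∧ finrank ℝ (hodgeGroupLie Ψ) = 49) ∨
      (finrank ℚ (centerField Ψ hX) = 14 ∧ finrank ℝ (hodgeGroupLie Ψ) = 7) := by
  rcases hX.finrank_centerField_mem_of_finrank_eq_seven hη h7 with ⟨hR, he | he⟩ | ⟨hCM, he | he⟩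
  · exact Or.inl ⟨he, hη.finrank_hodgeGroupLie_eq_of_finrank_eq_seven_of_endAlgRat_eq_bot h7
      (hX.endAlgRat_eq_bot_of_finrank_eq_one_of_finrank_centerField_eq_one (hX.finrank_centerField_endAlgRat_eq_one_of_finrank_eq_seven h7) he)⟩
  · haveI := hR
    refine Or.inr (Or.inl ⟨he, ?_⟩)
    rw [hX.finrank_hodgeGroupLie_eq_three_mul_of_finrank_centerField_eq hη (he.trans h7.symm), h7]
  · exact Or.inr (Or.inr (Or.inl ⟨he, hX.finrank_hodgeGroupLie_eq_of_finrank_centerField_eq_two_of_finrank_eq_seven hη h7 he⟩))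
  · haveI := hCM
    refine Or.inr (Or.inr (Or.inr ⟨he, ?_⟩))
    have hdim : finrank ℚ (endAlgRat Ψ) = Fintype.card κ := by
      rw [← hX.range_valAlgHom_eq_endAlgRat_of_finrank_eq_seven h7,
        ← (AlgEquiv.ofInjectiveField (centerField.valAlgHom Ψ hX)).toLinearEquiv.finrank_eq, he, card_eq_two_mul_finrank Ψ, h7]
    rw [← h7]
    exact (hX.forall_divisorClasses_powPeriod_eq_hodgeClasses_iff_finrank_hodgeGroupLie_eq_finrank_of_isCMField_of_endAlgRat_comm hη
      (hX.endAlgRat_comm_of_finrank_eq_seven h7) hdim).1 (hX.forall_divisorClasses_powPeriod_eq_hodgeClasses_of_finrank_eq_seven hη h7)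

end Simple

end ComplexTorus

end Literature.Geometry.Kaehler

end
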